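import Mathlib
import HarnessLib

/-!
# Stub E `stub_latticeGreenKubo` of line `kinetic-polymer-gas-on-the-time-axis`
(crux `EmbeddedDrudeMourre.DrudeDissolution`, item stmt-AtomisticToContinuum-12593; `--supports` file
proving the registered stub E verbatim, closes nothing)

WHAT. The lattice-to-continuum Green–Kubo lemma (pure real analysis, Mathlib only): a continuous
`C : ℝ → ℝ` which, cell by cell on the time lattice `t = Nν + s` (`ν > 0`, `s ∈ [0, ν)`), is summably
close to continuous main terms `m N` (`Σ_N |C(Nν+s) − m N s| ≤ Etot`), the main terms being summable
(`Σ_N |m N s| ≤ Mtot`) with `Σ_N ∫₀^ν m N = Ptot`, is integrable on `(0, ∞)` and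
`|∫₀^∞ C − Ptot| ≤ ν · Etot`.

PROOF. `(0, ∞)` is the disjoint union of the measurable cells `(Nν, (N+1)ν]`, and on each cell
`∫ C = ∫_{[0,ν)} C(Nν + ·)` (translation; endpoints are Lebesgue-null). Everything is reduced to FINITE
partial sums on the base cell `[0, ν)`, where the hypotheses hold pointwise:
`Σ_{N<n} ∫_{[0,ν)} |C(Nν+s)| ds = ∫_{[0,ν)} Σ_{N<n} |C(Nν+s)| ds ≤ ν (Mtot + Etot)` (as
`|C| ≤ |m| + |C − m|`), so the cell norms are summable and `C ∈ L¹(0,∞)`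
(`integrableOn_iUnion_of_summable_integral_norm`); `∫₀^∞ C = Σ_N ∫_{[0,ν)} C(Nν+·)`
(`hasSum_integral_iUnion`), hence `∫₀^∞ C − Ptot = Σ_N ∫_{[0,ν)} (C(Nν+s) − m N s) ds`, each partial
sum of which is `≤ ∫_{[0,ν)} Σ_{N<n} |C(Nν+s) − m N s| ds ≤ ν Etot` in absolute value; pass to the
limit (`le_of_tendsto'`).
-/

noncomputable section

open MeasureTheory Set Filter
open scoped Topology

namespace Summit.AtomisticToContinuum.FouriersLaw.Theorems.DrudeDissolution.KineticPolymerGasOnTheTimeAxis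

/-- An interval integral over `a..b` (`a ≤ b`) is the set integral over `[a, b)`: Lebesgue measure has
no atoms. [folklore] -/
theorem intervalIntegral_eq_setIntegral_Ico {a b : ℝ} (hab : a ≤ b) (f : ℝ → ℝ) :
    ∫ s in a..b, f s = ∫ s in Ico a b, f s := by
  rw [intervalIntegral.integral_of_le hab, integral_Ioc_eq_integral_Ioo, integral_Ico_eq_integral_Ioo]

/-- Translation of one cell: `∫_{(c, c+ν]} f = ∫_{[0, ν)} f (c + ·)` for `ν ≥ 0`. [folklore] -/
theorem setIntegral_Ioc_eq_setIntegral_Ico_comp_add (f : ℝ → ℝ) {ν : ℝ} (hν : 0 ≤ ν) (c : ℝ) :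
    ∫ x in Ioc c (c + ν), f x = ∫ s in Ico 0 ν, f (c + s) := by
  rw [← intervalIntegral_eq_setIntegral_Ico hν, intervalIntegral.integral_comp_add_left f c, add_zero,
    intervalIntegral.integral_of_le (le_add_of_nonneg_right hν)]

/-- The cells `(Nν, (N+1)ν]`, `N ∈ ℕ`, of a lattice of spacing `ν ≥ 0` are pairwise disjoint.
[folklore] -/
theorem pairwise_disjoint_Ioc_cells {ν : ℝ} (hν : 0 ≤ ν) :
    Pairwise (Function.onFun Disjoint fun N : ℕ => Ioc ((N : ℝ) * ν) ((N + 1) * ν)) := by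
  rw [pairwise_disjoint_on]
  intro M N hMN
  refine disjoint_left.2 fun x hxM hxN => ?_
  have h1 : ((M : ℝ) + 1) * ν ≤ N * ν := by
    have h2 : (M : ℝ) + 1 ≤ N := by exact_mod_cast Nat.succ_le_of_lt hMN
    exact mul_le_mul_of_nonneg_right h2 hν
  exact lt_irrefl x ((hxM.2.trans h1).trans_lt hxN.1)

/-- `(0, ∞)` is the union of the cells `(Nν, (N+1)ν]`, `N ∈ ℕ`, of a lattice of spacing `ν > 0`
(the cell of `t > 0` has index `⌈t/ν⌉ − 1`). [folklore] -/
theorem iUnion_Ioc_cells {ν : ℝ} (hν : 0 < ν) :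
    ⋃ N : ℕ, Ioc ((N : ℝ) * ν) ((N + 1) * ν) = Ioi 0 := by
  refine Set.ext fun t => ⟨fun ht => ?_, fun ht => ?_⟩
  · obtain ⟨N, hN⟩ := mem_iUnion.1 ht
    exact mem_Ioi.2 ((mul_nonneg (Nat.cast_nonneg N) hν.le).trans_lt hN.1)
  · have htν : 0 < t / ν := div_pos ht hν
    obtain ⟨k, hk⟩ := Nat.exists_eq_add_one_of_ne_zero (Nat.ceil_pos.2 htν).ne'
    refine mem_iUnion.2 ⟨k, ?_, ?_⟩
    · have h1 : (⌈t / ν⌉₊ : ℝ) < t / ν + 1 := Nat.ceil_lt_add_one htν.le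
      rw [hk] at h1
      push_cast at h1
      have h2 : (k : ℝ) < t / ν := by linarith
      rwa [lt_div_iff₀ hν] at h2
    · have h1 : t / ν ≤ (⌈t / ν⌉₊ : ℝ) := Nat.le_ceil _
      rw [hk] at h1
      push_cast at h1
      rwa [div_le_iff₀ hν] at h1

/-- **Stub E — lattice-to-continuum Green–Kubo lemma.** If a continuous `C : ℝ → ℝ` is, on every cell
`[Nν, (N+1)ν)` of a lattice of spacing `ν > 0`, close to continuous main terms `m N : ℝ → ℝ` in the
summed sense `Σ_N |C(Nν+s) − m N s| ≤ Etot` for every offset `s ∈ [0, ν)`, the main terms are summable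
`Σ_N |m N s| ≤ Mtot`, and `Σ_N ∫₀^ν m N = Ptot`, then `C ∈ L¹(0, ∞)` and `|∫₀^∞ C − Ptot| ≤ ν·Etot`.
[folklore] -/
theorem stub_latticeGreenKubo :
    ∀ (Cf : ℝ → ℝ) (m : ℕ → ℝ → ℝ) (ν Etot Mtot Ptot : ℝ), 0 < ν →
      Continuous Cf → (∀ N : ℕ, Continuous (m N)) →
      (∀ s ∈ Set.Ico (0 : ℝ) ν, Summable (fun N : ℕ => |Cf (N * ν + s) - m N s|) ∧
        ∑' N : ℕ, |Cf (N * ν + s) - m N s| ≤ Etot) →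
      (∀ s ∈ Set.Ico (0 : ℝ) ν, Summable (fun N : ℕ => |m N s|) ∧ ∑' N : ℕ, |m N s| ≤ Mtot) →
      HasSum (fun N : ℕ => ∫ s in (0 : ℝ)..ν, m N s) Ptot →
      MeasureTheory.IntegrableOn Cf (Set.Ioi 0) ∧ |(∫ t in Set.Ioi (0 : ℝ), Cf t) - Ptot| ≤ ν * Etot := by
  intro Cf m ν Etot Mtot Ptot hν hC hm hE hM hP
  -- integrability of the summands on the base cell `[0, ν)` and its volume
  have hF : ∀ N : ℕ, IntegrableOn (fun s : ℝ => Cf (N * ν + s)) (Ico 0 ν) := fun N =>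
    (Continuous.integrableOn_Icc (by fun_prop)).mono_set Ico_subset_Icc_self
  have hmI : ∀ N : ℕ, IntegrableOn (m N) (Ico 0 ν) := fun N =>
    (hm N).integrableOn_Icc.mono_set Ico_subset_Icc_self
  have hvol : volume.real (Ico (0 : ℝ) ν) = ν := by
    rw [Real.volume_real_Ico_of_le hν.le, sub_zero]
  -- the cells and the cell integrals
  have hcell : ∀ (f : ℝ → ℝ) (N : ℕ),
      ∫ x in Ioc ((N : ℝ) * ν) ((N + 1) * ν), f x = ∫ s in Ico (0 : ℝ) ν, f (N * ν + s) := by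
    intro f N
    rw [add_one_mul]
    exact setIntegral_Ioc_eq_setIntegral_Ico_comp_add f hν.le _
  have hU := iUnion_Ioc_cells hν
  -- (1) the cell norms of `Cf` have bounded partial sums, hence `Cf ∈ L¹(0, ∞)`
  have hCsum : ∀ n : ℕ,
      ∑ k ∈ Finset.range n, ∫ s in Ico (0 : ℝ) ν, |Cf (k * ν + s)| ≤ ν * (Mtot + Etot) := by
    intro n
    have hswap : ∫ s in Ico (0 : ℝ) ν, ∑ k ∈ Finset.range n, |Cf (k * ν + s)|
        = ∑ k ∈ Finset.range n, ∫ s in Ico (0 : ℝ) ν, |Cf (k * ν + s)| :=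
      integral_finsetSum _ fun k _ => (hF k).abs
    rw [← hswap]
    calc ∫ s in Ico (0 : ℝ) ν, ∑ k ∈ Finset.range n, |Cf (k * ν + s)|
        ≤ ∫ _ in Ico (0 : ℝ) ν, (Mtot + Etot) := by
          refine setIntegral_mono_on (integrable_finsetSum _ fun k _ => (hF k).abs)
            (integrableOn_const measure_Ico_lt_top.ne) measurableSet_Ico fun s hs => ?_
          calc ∑ k ∈ Finset.range n, |Cf (k * ν + s)|
              ≤ ∑ k ∈ Finset.range n, (|m k s| + |Cf (k * ν + s) - m k s|) :=
                Finset.sum_le_sum fun k _ => by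
                  have h := abs_sub_abs_le_abs_sub (Cf (k * ν + s)) (m k s)
                  linarith
            _ = ∑ k ∈ Finset.range n, |m k s| + ∑ k ∈ Finset.range n, |Cf (k * ν + s) - m k s| :=
                Finset.sum_add_distrib
            _ ≤ ∑' k : ℕ, |m k s| + ∑' k : ℕ, |Cf (k * ν + s) - m k s| :=
                add_le_add ((hM s hs).1.sum_le_tsum _ fun k _ => abs_nonneg _)
                  ((hE s hs).1.sum_le_tsum _ fun k _ => abs_nonneg _)
            _ ≤ Mtot + Etot := add_le_add (hM s hs).2 (hE s hs).2
      _ = ν * (Mtot + Etot) := by rw [setIntegral_const, hvol, smul_eq_mul]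
  have hsum : Summable fun N : ℕ => ∫ x in Ioc ((N : ℝ) * ν) ((N + 1) * ν), ‖Cf x‖ := by
    have heq : (fun N : ℕ => ∫ x in Ioc ((N : ℝ) * ν) ((N + 1) * ν), ‖Cf x‖)
        = fun N : ℕ => ∫ s in Ico (0 : ℝ) ν, |Cf (N * ν + s)| := by
      funext N
      rw [hcell (fun x => ‖Cf x‖) N]
      simp only [Real.norm_eq_abs]
    rw [heq]
    exact summable_of_sum_range_le (fun N => integral_nonneg fun s => abs_nonneg _) hCsum
  have hint' : IntegrableOn Cf (⋃ N : ℕ, Ioc ((N : ℝ) * ν) ((N + 1) * ν)) :=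
    integrableOn_iUnion_of_summable_integral_norm (fun N => hC.integrableOn_Ioc) hsum
  have hint : IntegrableOn Cf (Ioi 0) := by
    rw [← hU]
    exact hint'
  -- (2) `∫₀^∞ Cf − Ptot = Σ_N ∫_{[0,ν)} (Cf (Nν + s) − m N s) ds`
  have h1 : HasSum (fun N : ℕ => ∫ s in Ico (0 : ℝ) ν, Cf (N * ν + s)) (∫ t in Ioi (0 : ℝ), Cf t) := by
    have h := hasSum_integral_iUnion (s := fun N : ℕ => Ioc ((N : ℝ) * ν) ((N + 1) * ν))
      (fun N : ℕ => measurableSet_Ioc) (pairwise_disjoint_Ioc_cells hν.le) hint'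
    have hfun : (fun N : ℕ => ∫ x in Ioc ((N : ℝ) * ν) ((N + 1) * ν), Cf x)
        = fun N : ℕ => ∫ s in Ico (0 : ℝ) ν, Cf (N * ν + s) :=
      funext fun N => hcell Cf N
    rw [hU, hfun] at h
    exact h
  have h2 : HasSum (fun N : ℕ => ∫ s in Ico (0 : ℝ) ν, m N s) Ptot := by
    have hfun : (fun N : ℕ => ∫ s in (0 : ℝ)..ν, m N s) = fun N : ℕ => ∫ s in Ico (0 : ℝ) ν, m N s :=
      funext fun N => intervalIntegral_eq_setIntegral_Ico hν.le (m N)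
    rw [hfun] at hP
    exact hP
  have h3 : HasSum (fun N : ℕ => ∫ s in Ico (0 : ℝ) ν, (Cf (N * ν + s) - m N s))
      ((∫ t in Ioi (0 : ℝ), Cf t) - Ptot) := by
    have hfun : (fun N : ℕ => ∫ s in Ico (0 : ℝ) ν, (Cf (N * ν + s) - m N s))
        = fun N : ℕ => (∫ s in Ico (0 : ℝ) ν, Cf (N * ν + s)) - ∫ s in Ico (0 : ℝ) ν, m N s :=
      funext fun N => integral_sub (hF N) (hmI N)
    rw [hfun]
    exact h1.sub h2
  -- (3) every partial sum is `≤ ν · Etot` in absolute value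
  have h4 : ∀ n : ℕ,
      |∑ N ∈ Finset.range n, ∫ s in Ico (0 : ℝ) ν, (Cf (N * ν + s) - m N s)| ≤ ν * Etot := by
    intro n
    have hswap : ∫ s in Ico (0 : ℝ) ν, ∑ N ∈ Finset.range n, (Cf (N * ν + s) - m N s)
        = ∑ N ∈ Finset.range n, ∫ s in Ico (0 : ℝ) ν, (Cf (N * ν + s) - m N s) :=
      integral_finsetSum _ fun N _ => (hF N).sub' (hmI N)
    rw [← hswap]
    calc |∫ s in Ico (0 : ℝ) ν, ∑ N ∈ Finset.range n, (Cf (N * ν + s) - m N s)|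
        ≤ ∫ s in Ico (0 : ℝ) ν, |∑ N ∈ Finset.range n, (Cf (N * ν + s) - m N s)| :=
          abs_integral_le_integral_abs
      _ ≤ ∫ _ in Ico (0 : ℝ) ν, Etot := by
          refine setIntegral_mono_on (integrable_finsetSum _ fun N _ => (hF N).sub' (hmI N)).abs
            (integrableOn_const measure_Ico_lt_top.ne) measurableSet_Ico fun s hs => ?_
          calc |∑ N ∈ Finset.range n, (Cf (N * ν + s) - m N s)|
              ≤ ∑ N ∈ Finset.range n, |Cf (N * ν + s) - m N s| := Finset.abs_sum_le_sum_abs _ _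
            _ ≤ ∑' N : ℕ, |Cf (N * ν + s) - m N s| :=
                (hE s hs).1.sum_le_tsum _ fun N _ => abs_nonneg _
            _ ≤ Etot := (hE s hs).2
      _ = ν * Etot := by rw [setIntegral_const, hvol, smul_eq_mul]
  -- (4) pass to the limit
  exact ⟨hint, le_of_tendsto' ((continuous_abs.tendsto _).comp h3.tendsto_sum_nat) h4⟩

end Summit.AtomisticToContinuum.FouriersLaw.Theorems.DrudeDissolution.KineticPolymerGasOnTheTimeAxis

end
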